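import Literature.NumberTheory.LFunctions.EffectivePrimeIdealTheoremGRHFromPsi
import Literature.NumberTheory.LFunctions.DedekindPsiGRHBound
import HarnessLib

/-!
# The effective prime ideal theorem under GRH (Lagarias–Odlyzko; Serre 1981, Thm. 4): the discharge

Topic `Literature/NumberTheory/LFunctions` (namespace `Literature.NumberTheory.LFunctions.NumberField`,
sibling of `EffectivePrimeIdealTheoremGRH.lean`). Everything in this file is PROVED.

The named fact `effectivePrimeIdealTheorem_of_ERH` (`EffectivePrimeIdealTheoremGRH.lean`; Serre 1981,
Thm. 4 (14_R) for `E = K`; Lagarias–Odlyzko 1977, Thm. 1.1 under GRH): *there is an absolute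
`c > 0` such that for every number field `K` whose Dedekind zeta function satisfies GRH and every
`x ≥ 2`, `|π_K(x) − Li(x)| ≤ c √x (log|d_K| + [K:ℚ] log x)`* — is DISCHARGED here
(`effectivePrimeIdealTheorem_of_ERH_holds`) by combining

* the `ψ`-form, proved uniformly in `K` in `DedekindPsiGRHBound.lean`
  (`Literature.NumberTheory.LFunctions.exists_abs_chebyshevPsiIdeal_sub_self_le_of_erh`:
  `|ψ_K(x) − x| ≤ c √x log x (log|d_K| + [K:ℚ] log x)` for `x ≥ 2`, Lagarias–Odlyzko Thm. 9.1), and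
* the partial-summation transfer `ψ_K → π_K` of `EffectivePrimeIdealTheoremGRHFromPsi.lean`
  (`effectivePrimeIdealTheorem_of_ERH_of_chebyshevPsiIdeal`, Winckler 2013, §8).

## References

* J.-P. Serre, *Quelques applications du théorème de densité de Chebotarev*, Publ. Math. IHÉS 54
  (1981), 123–201, Thm. 4. [cite: Serre1981, Thm. 4 (14_R) p. 133]
* J. C. Lagarias, A. M. Odlyzko, *Effective versions of the Chebotarev density theorem*, in:
  Algebraic Number Fields (Durham 1975), Academic Press 1977, 409–464, Thm. 1.1, Thm. 9.1.
  [cite: LagariasOdlyzko1977, Thm. 1.1]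
* B. Winckler, *Théorème de Chebotarev effectif*, arXiv:1311.5715 (2013), Thm. 1.2, Thm. 8.1.
  [cite: Winckler2013, Thm. 1.2]
-/

noncomputable section

namespace Literature.NumberTheory.LFunctions.NumberField

/-- **The effective prime ideal theorem under GRH holds** (Serre 1981, Thm. 4 (14_R), `E = K`;
Lagarias–Odlyzko 1977, Thm. 1.1 under GRH): the named fact `effectivePrimeIdealTheorem_of_ERH` is a
theorem — from the uniform GRH bound for `ψ_K` (`exists_abs_chebyshevPsiIdeal_sub_self_le_of_erh`,
`DedekindPsiGRHBound.lean`) by partial summation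
(`effectivePrimeIdealTheorem_of_ERH_of_chebyshevPsiIdeal`). [cite: Serre1981, Thm. 4 (14_R) p. 133] -/
theorem effectivePrimeIdealTheorem_of_ERH_holds : effectivePrimeIdealTheorem_of_ERH :=
  effectivePrimeIdealTheorem_of_ERH_of_chebyshevPsiIdeal
    Literature.NumberTheory.LFunctions.exists_abs_chebyshevPsiIdeal_sub_self_le_of_erh

/-- Under the Extended Riemann Hypothesis for all number fields, the effective prime ideal theorem
holds unconditionally on the named fact (now a theorem): for every number field `K : Type` and
`x ≥ 2`, `|π_K(x) − Li(x)| ≤ c √x (log|d_K| + [K:ℚ] log x)` with one absolute `c`.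
[cite: Serre1981, Thm. 4 (14_R) p. 133] -/
theorem effectivePrimeIdealTheorem_of_extendedRiemannHypothesis
    (hERH : Literature.NumberTheory.LFunctions.ExtendedRiemannHypothesis) :
    ∃ c : ℝ, 0 < c ∧ ∀ (K : Type) [Field K] [NumberField K], ∀ x : ℝ, 2 ≤ x →
      |(primeIdealCount K x : ℝ) - offsetLogIntegral x| ≤
        c * Real.sqrt x *
          (Real.log |(_root_.NumberField.discr K : ℝ)| + Module.finrank ℚ K * Real.log x) :=
  effectivePrimeIdealTheorem_of_ERH_holds.of_extendedRiemannHypothesis hERH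

end Literature.NumberTheory.LFunctions.NumberField

end
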